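import Summits.QuantumFields.YangMills.Theorems.BalabanLadderIRTypBallSparse
import HarnessLib

/-!
# The excess-sparse (action-budget) typicality factor `Typ_xs`: definitions, format conjuncts, comparison, choice set

Support file (seat ym-infvol-p3, fleet R136 (i); crux `IR` = stmt-QuantumFields-19354, registered line «af-pincer-U»
(owner R59-U, `line-af-pincer-U.reg.lean` fc8c6b10a3fbcbe2; clause (iii) of `TypShellCondUKP` = clause (iii_T) verbatim);
count-neutral helper).  The crux-plan seat's CONTAGION-NOTE-g6 (b35aa41ce43a0be9, adopted by the owner in R59 (C)) retires
the ball-sparse COUNT factor `Typ_bs` of the working class (it fails the range-1 contagion test) in favour of the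
**excess-sparse class**

  `typExcessSparse ρ w t₀ R E₀ c = {U | ∀ x, ∑_{q ∈ cellPlaqs w c, |q.1 - x|_∞ ≤ R} (s_q(U) - t₀)₊ ≤ E₀}`,  `s_q = N - Re tr ρ(U_q)`,

at scales `t₀ = K log β / β`, `R = R₀`, `E₀` CONSTANT in `β` (note §3.3), typed in the seat's `Sketch-g6-contagion.lean`
§X (54cc5c8c1ace2e8b) with its format conjuncts and the comparison with `Typ_bs`.  §1–§3 below are that §X landed as a
tree module (lowercase def names; `plaquetteEdges_subset_of_mem_cellPlaqs` / `plaquetteHolonomyZd_congr` are already in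
`…IRTypBallSparse`); §4 is the CHOICE SET of the union bound for its torus anchor (note §3.4 (J): «torus (iii_T) —
chessboard over disjoint cells [heur arithmetic, decls in tree]»), proved in the companion file
`…IRTypExcessSparseAnchor`:

* §1 `plaqAction`, `ballPlaqs`, `excessIn`, `typExcessSparse`;
* §2 `typExcessSparse_dependsOn`, `measurableSet_typExcessSparse` (the two witness conjuncts of `TypShellCond[UKP]`),
  `one_mem_typExcessSparse`, `typExcessSparse_mono`;
* §3 `typBallSparse_subset_typExcessSparse` (`Typ_bs(t₀,R,D) ⊆ Typ_xs(t₀,R,2N·D)`, unitary `ρ`) and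
  `typExcessSparse_subset_typBallSparse` (`Typ_xs(t₀,R,E₀) ⊆ Typ_bs(t₁,R,⌊E₀/(t₁-t₀)⌋₊)`, `t₀ < t₁`);
* §4 `excessChoices w R c` (all subsets of the cell's plaquettes within sup-distance `2R` of one member),
  `exists_mem_excessChoices_of_notMem` (for `t₀, E₀ ≥ 0`: an atypical configuration has a member `Q` of the choice set
  with `∑_{q ∈ Q} s_q > E₀` — take the super-threshold plaquettes of an over-budget ball), `card_excessChoices_le`
  (`≤ (2b)⁴ m · 2^((4R+1)⁴ m)`) and `card_le_of_mem_excessChoices` (`#Q ≤ (4R+1)⁴ m`).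

Everything here is proved (no `sorry`, no new axioms).  HONEST FRAMING: typing and finite combinatorics for ONE `Typ`
factor of a registered line of a CONDITIONAL chain; the factor's kernel-level rarity ((ii) in UKP form — note §3.4 (A),
the R46.3 debt) and (i_T) are NOT touched; not a gap, not Clay.
-/

set_option autoImplicit false

noncomputable section

open MeasureTheory Finset
open Literature.MathematicalPhysics
open Literature.MathematicalPhysics.QuantumFieldTheory Literature.MathematicalPhysics.QuantumLattice
open Literature.Probability.LatticeModels (Site)
open Summit.QuantumFields.YangMills.Cruxes.IR.Tempered (cellEdges)

namespace Summit.QuantumFields.YangMills.Theorems.OddTorusChessboard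

variable {G : Type} [Group G] {N : ℕ} (ρ : G →* Matrix (Fin N) (Fin N) ℂ)

/-! ### §1 Definitions (crux-plan seat ym-cplan-19354-af-pincer g6, Sketch-g6 §X.1, verbatim up to def names) -/

/-- The plaquette action `s_q(U) = N - Re tr ρ(U_q)` of the plaquette `q` (the tree's small-field quantity,
`BalabanRG.smallFieldRegion`; `= ½‖ρ(U_q) - 1‖²_HS` for unitary `ρ`). -/
def plaqAction (q : ZdPlaquette 4) (U : LGConfig 4 G) : ℝ :=
  (N : ℝ) - plaquetteObs ρ q.1 q.2.1.1 q.2.1.2 U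

/-- The cell's own plaquettes with base point in the sup-norm ball of radius `R` about `x`. -/
def ballPlaqs (w : Fin 4 → ℤ → ℤ) (c : Fin 4 → ℤ) (R : ℕ) (x : Site 4) : Finset (ZdPlaquette 4) :=
  (cellPlaqs w c).filter fun q => ∀ i, |q.1 i - x i| ≤ (R : ℤ)

/-- The **excess action** of the cell `c` in the `R`-ball about `x` above the threshold `t₀`:
`∑_{q ∈ ballPlaqs} (s_q - t₀)₊`. -/
def excessIn (w : Fin 4 → ℤ → ℤ) (t₀ : ℝ) (R : ℕ) (c : Fin 4 → ℤ) (x : Site 4) (U : LGConfig 4 G) : ℝ :=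
  ∑ q ∈ ballPlaqs w c R x, max (plaqAction ρ q U - t₀) 0

/-- **The excess-sparse class of a cell** `Typ_xs(c; t₀, R, E₀)` (desk name `TypExcessSparse`): in every sup-norm
`R`-ball the excess action of the cell's own plaquettes above `t₀` is at most `E₀`.  CONTAGION-NOTE-g6 §3.3 scales:
`t₀ = K log β / β`, `R = R₀`, `E₀` constant in `β`. -/
def typExcessSparse (w : Fin 4 → ℤ → ℤ) (t₀ : ℝ) (R : ℕ) (E₀ : ℝ) (c : Fin 4 → ℤ) : Set (LGConfig 4 G) :=
  {U | ∀ x : Site 4, excessIn ρ w t₀ R c x U ≤ E₀}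

/-! ### §2 Cell-locality, measurability, non-vacuity, monotonicity (Sketch-g6 §X.2) -/

/-- The plaquette action is read off the plaquette's four edges. -/
theorem plaqAction_congr {U V : LGConfig 4 G} (q : ZdPlaquette 4) (h : ∀ e ∈ plaquetteEdges q, U e = V e) :
    plaqAction ρ q U = plaqAction ρ q V := by
  unfold plaqAction plaquetteObs
  rw [plaquetteHolonomyZd_congr q h]

/-- The excess action of the cell in a ball is read off the cell's own edges. -/
theorem excessIn_congr {w : Fin 4 → ℤ → ℤ} {t₀ : ℝ} {R : ℕ} {c : Fin 4 → ℤ} {x : Site 4} {U V : LGConfig 4 G}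
    (hUV : ∀ e ∈ (↑(cellEdges w c) : Set (QuantumLattice.ZdEdge 4)), U e = V e) :
    excessIn ρ w t₀ R c x U = excessIn ρ w t₀ R c x V := by
  unfold excessIn
  refine Finset.sum_congr rfl fun q hq => ?_
  have hq' : q ∈ cellPlaqs w c := (Finset.mem_filter.1 hq).1
  rw [plaqAction_congr ρ q fun e he => hUV e (Finset.mem_coe.2 (plaquetteEdges_subset_of_mem_cellPlaqs hq' he))]

/-- **(second conjunct of `TypShellCond[UKP]` for this factor)** `Typ_xs(c)` is read off the cell's own edges. -/
theorem typExcessSparse_dependsOn (w : Fin 4 → ℤ → ℤ) (t₀ : ℝ) (R : ℕ) (E₀ : ℝ) (c : Fin 4 → ℤ) :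
    DependsOn (fun U : LGConfig 4 G => U ∈ typExcessSparse ρ w t₀ R E₀ c) ↑(cellEdges w c) := by
  intro U V hUV
  show (U ∈ typExcessSparse ρ w t₀ R E₀ c) = (V ∈ typExcessSparse ρ w t₀ R E₀ c)
  simp only [typExcessSparse, Set.mem_setOf_eq, excessIn_congr ρ hUV]

/-- The plaquette action vanishes at the trivial configuration (`Re tr ρ(1) = N`). -/
theorem plaqAction_one (q : ZdPlaquette 4) : plaqAction ρ q (1 : LGConfig 4 G) = 0 := by
  simp [plaqAction, plaquetteObs, plaquetteHolonomyZd, Matrix.trace_one, Fintype.card_fin]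

/-- Non-vacuity: the trivial configuration is excess-sparse-typical for `t₀, E₀ ≥ 0`. -/
theorem one_mem_typExcessSparse (w : Fin 4 → ℤ → ℤ) {t₀ E₀ : ℝ} (ht₀ : 0 ≤ t₀) (hE : 0 ≤ E₀) (R : ℕ)
    (c : Fin 4 → ℤ) : (1 : LGConfig 4 G) ∈ typExcessSparse ρ w t₀ R E₀ c := by
  intro x
  have h0 : ∀ q ∈ ballPlaqs w c R x, max (plaqAction ρ q (1 : LGConfig 4 G) - t₀) 0 = 0 := fun q _ => by
    rw [plaqAction_one]; exact max_eq_right (by linarith)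
  unfold excessIn
  rw [Finset.sum_congr rfl h0, Finset.sum_const_zero]
  exact hE

/-- `Typ_xs` is monotone in the threshold and in the budget. -/
theorem typExcessSparse_mono (w : Fin 4 → ℤ → ℤ) {t₀ t₀' : ℝ} (ht : t₀ ≤ t₀') {R : ℕ} {E₀ E₀' : ℝ} (hE : E₀ ≤ E₀')
    (c : Fin 4 → ℤ) : typExcessSparse ρ w t₀ R E₀ c ⊆ typExcessSparse ρ w t₀' R E₀' c := by
  intro U hU x
  have hmono : excessIn ρ w t₀' R c x U ≤ excessIn ρ w t₀ R c x U := by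
    unfold excessIn
    exact Finset.sum_le_sum fun q _ => max_le_max (by linarith) le_rfl
  exact hmono.trans ((hU x).trans hE)

/-- The plaquette action of a continuous representation is measurable. -/
theorem measurable_plaqAction [TopologicalSpace G] [IsTopologicalGroup G] [MeasurableSpace G] [BorelSpace G]
    [SecondCountableTopology G] (hρ : Continuous ρ) (q : ZdPlaquette 4) : Measurable (plaqAction ρ q) :=
  measurable_const.sub (measurable_plaquetteObs ρ hρ q.1 q.2.1.1 q.2.1.2)

/-- The excess action in a ball is measurable. -/
theorem measurable_excessIn [TopologicalSpace G] [IsTopologicalGroup G] [MeasurableSpace G] [BorelSpace G]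
    [SecondCountableTopology G] (hρ : Continuous ρ) (w : Fin 4 → ℤ → ℤ) (t₀ : ℝ) (R : ℕ) (c : Fin 4 → ℤ)
    (x : Site 4) : Measurable (excessIn ρ w t₀ R c x) := by
  show Measurable fun U => ∑ q ∈ ballPlaqs w c R x, max (plaqAction ρ q U - t₀) 0
  exact Finset.measurable_sum _ fun q _ => ((measurable_plaqAction ρ hρ q).sub measurable_const).max
    measurable_const

/-- **(first conjunct of `TypShellCond[UKP]` for this factor)** (continuous `ρ`, second-countable `G`): `Typ_xs(c)` is a
countable intersection (over ball centres) of sub-level sets of measurable functions. -/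
theorem measurableSet_typExcessSparse [TopologicalSpace G] [IsTopologicalGroup G] [MeasurableSpace G]
    [BorelSpace G] [SecondCountableTopology G] (hρ : Continuous ρ) (w : Fin 4 → ℤ → ℤ) (t₀ : ℝ) (R : ℕ)
    (E₀ : ℝ) (c : Fin 4 → ℤ) : MeasurableSet (typExcessSparse (G := G) ρ w t₀ R E₀ c) := by
  have hrepr : typExcessSparse (G := G) ρ w t₀ R E₀ c = ⋂ x : Site 4, {U | excessIn ρ w t₀ R c x U ≤ E₀} := by
    ext U
    simp [typExcessSparse, Set.mem_iInter]
  rw [hrepr]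
  exact MeasurableSet.iInter fun x => measurableSet_le (measurable_excessIn ρ hρ w t₀ R c x) measurable_const

/-! ### §3 Comparison with the ball-sparse COUNT class `typBallSparse` (Sketch-g6 §X.3) -/

/-- For unitary `ρ` the plaquette action is at most `2N`. -/
theorem plaqAction_le_two_mul (hρu : ∀ g, ρ g ∈ Matrix.unitaryGroup (Fin N) ℂ) (q : ZdPlaquette 4)
    (U : LGConfig 4 G) : plaqAction ρ q U ≤ 2 * N := by
  have h := abs_plaquetteObs_le_holds (d := 4) ρ hρu q.1 q.2.1.1 q.2.1.2 U
  have h' := neg_le_of_abs_le h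
  unfold plaqAction
  linarith

/-- `Typ_bs(t₀, R, D) ⊆ Typ_xs(t₀, R, 2N·D)` for unitary `ρ` and `t₀ ≥ 0`: off the exceptional set the excess vanishes,
on it each plaquette contributes at most `2N`, and at most `D` exceptional plaquettes meet a ball. -/
theorem typBallSparse_subset_typExcessSparse (hρu : ∀ g, ρ g ∈ Matrix.unitaryGroup (Fin N) ℂ)
    (w : Fin 4 → ℤ → ℤ) {t₀ : ℝ} (ht₀ : 0 ≤ t₀) (R D : ℕ) (c : Fin 4 → ℤ) :
    typBallSparse ρ w t₀ R D c ⊆ typExcessSparse ρ w t₀ R (2 * N * D) c := by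
  classical
  rintro U ⟨X, hX, hsp, hsf⟩ x
  have hpt : ∀ q ∈ ballPlaqs w c R x,
      max (plaqAction ρ q U - t₀) 0 ≤ if q ∈ X then (2 * N : ℝ) else 0 := by
    intro q hq
    have hqc : q ∈ cellPlaqs w c := (Finset.mem_filter.1 hq).1
    by_cases hqX : q ∈ X
    · rw [if_pos hqX]
      refine max_le ?_ (by positivity)
      linarith [plaqAction_le_two_mul ρ hρu q U]
    · rw [if_neg hqX]
      refine max_le ?_ le_rfl
      have hsmall := hsf q (Finset.mem_coe.2 (Finset.mem_sdiff.2 ⟨hqc, hqX⟩))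
      unfold plaqAction
      linarith
  have hsum : excessIn ρ w t₀ R c x U ≤ ∑ q ∈ ballPlaqs w c R x, (if q ∈ X then (2 * N : ℝ) else 0) :=
    Finset.sum_le_sum hpt
  rw [Finset.sum_ite, Finset.sum_const_zero, add_zero, Finset.sum_const, nsmul_eq_mul] at hsum
  have hcard : ((ballPlaqs w c R x).filter fun q => q ∈ X).card ≤ D := by
    refine le_trans (Finset.card_le_card ?_) (hsp x)
    intro q hq
    rw [Finset.mem_filter] at hq ⊢
    exact ⟨hq.2, (Finset.mem_filter.1 hq.1).2⟩
  calc excessIn ρ w t₀ R c x U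
      ≤ (((ballPlaqs w c R x).filter fun q => q ∈ X).card : ℝ) * (2 * N) := hsum
    _ ≤ (D : ℝ) * (2 * N) := by gcongr
    _ = 2 * N * D := by ring

/-- `Typ_xs(t₀, R, E₀) ⊆ Typ_bs(t₁, R, ⌊E₀/(t₁ - t₀)⌋₊)` for `t₀ < t₁`: the plaquettes with action `> t₁` form an
admissible exceptional set (each carries excess `≥ t₁ - t₀`), off which every plaquette of the cell is `t₁`-small-field. -/
theorem typExcessSparse_subset_typBallSparse (w : Fin 4 → ℤ → ℤ) {t₀ t₁ : ℝ} (ht : t₀ < t₁) (R : ℕ) (E₀ : ℝ)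
    (c : Fin 4 → ℤ) : typExcessSparse ρ w t₀ R E₀ c ⊆ typBallSparse ρ w t₁ R ⌊E₀ / (t₁ - t₀)⌋₊ c := by
  classical
  intro U hU
  refine ⟨(cellPlaqs w c).filter fun q => t₁ < plaqAction ρ q U, Finset.filter_subset _ _, ?_, ?_⟩
  · intro x
    set S := ((cellPlaqs w c).filter fun q => t₁ < plaqAction ρ q U).filter
      fun p => ∀ i, |p.1 i - x i| ≤ (R : ℤ) with hS
    have hSsub : S ⊆ ballPlaqs w c R x := by
      intro q hq
      rw [hS, Finset.mem_filter, Finset.mem_filter] at hq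
      exact Finset.mem_filter.2 ⟨hq.1.1, hq.2⟩
    have hlow : (S.card : ℝ) * (t₁ - t₀) ≤ excessIn ρ w t₀ R c x U := by
      have h1 : (S.card : ℝ) * (t₁ - t₀) = S.card • (t₁ - t₀) := by rw [nsmul_eq_mul]
      rw [h1]
      refine le_trans (Finset.card_nsmul_le_sum S (fun q => max (plaqAction ρ q U - t₀) 0) _ fun q hq => ?_) ?_
      · rw [hS, Finset.mem_filter, Finset.mem_filter] at hq
        exact le_trans (by linarith [hq.1.2]) (le_max_left _ _)
      · unfold excessIn
        exact Finset.sum_le_sum_of_subset_of_nonneg hSsub fun q _ _ => le_max_right _ _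
    have hpos : 0 < t₁ - t₀ := sub_pos.2 ht
    have hcardR : (S.card : ℝ) ≤ E₀ / (t₁ - t₀) := by
      rw [le_div_iff₀ hpos]
      exact hlow.trans (hU x)
    exact Nat.le_floor hcardR
  · intro q hq
    have hq' := Finset.mem_sdiff.1 (Finset.mem_coe.1 hq)
    have hnot : ¬ t₁ < plaqAction ρ q U := fun hlt => hq'.2 (Finset.mem_filter.2 ⟨hq'.1, hlt⟩)
    have hle : plaqAction ρ q U ≤ t₁ := not_lt.1 hnot
    unfold plaqAction at hle
    exact hle

/-! ### §4 The choice set of an atypical cell (for the union bound of the torus anchor) -/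

/-- **The choice set**: all subsets of the cell's plaquettes lying within sup-distance `2R` of one of the cell's
plaquettes (`nearPlaqs w R c q₀`, `…IRTypBallSparse`). -/
def excessChoices (w : Fin 4 → ℤ → ℤ) (R : ℕ) (c : Fin 4 → ℤ) : Finset (Finset (ZdPlaquette 4)) :=
  (cellPlaqs w c).biUnion fun q₀ => (nearPlaqs w R c q₀).powerset

omit [Group G] in
/-- A member of the choice set consists of cell plaquettes, at most `(4R+1)⁴ m` of them. -/
theorem card_le_of_mem_excessChoices {w : Fin 4 → ℤ → ℤ} {R : ℕ} {c : Fin 4 → ℤ} {Q : Finset (ZdPlaquette 4)}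
    (hQ : Q ∈ excessChoices w R c) : Q ⊆ cellPlaqs w c ∧ #Q ≤ (4 * R + 1) ^ 4 * Fintype.card (Orient 4) := by
  obtain ⟨q₀, _, hQ⟩ := Finset.mem_biUnion.1 hQ
  have hsub := Finset.mem_powerset.1 hQ
  exact ⟨hsub.trans (Finset.filter_subset _ _), (Finset.card_le_card hsub).trans (card_nearPlaqs_le w R c q₀)⟩

omit [Group G] in
/-- **The size of the choice set**: `#excessChoices w R c ≤ (2b)⁴ m · 2^((4R+1)⁴ m)` for a cell of a mesh-`b` grid. -/
theorem card_excessChoices_le {w : Fin 4 → ℤ → ℤ} {b : ℕ}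
    (hw : ∀ i j, w i j + ((b : ℕ) : ℤ) ≤ w i (j + 1) ∧ w i (j + 1) ≤ w i j + 2 * ((b : ℕ) : ℤ)) (R : ℕ)
    (c : Fin 4 → ℤ) :
    #(excessChoices w R c) ≤
      ((2 * b) ^ 4 * Fintype.card (Orient 4)) * 2 ^ ((4 * R + 1) ^ 4 * Fintype.card (Orient 4)) := by
  classical
  unfold excessChoices
  refine Finset.card_biUnion_le.trans ?_
  calc ∑ q₀ ∈ cellPlaqs w c, #((nearPlaqs w R c q₀).powerset)
      ≤ ∑ _q₀ ∈ cellPlaqs w c, 2 ^ ((4 * R + 1) ^ 4 * Fintype.card (Orient 4)) := by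
        refine Finset.sum_le_sum fun q₀ _ => ?_
        rw [Finset.card_powerset]
        exact Nat.pow_le_pow_right (by norm_num) (card_nearPlaqs_le w R c q₀)
    _ = #(cellPlaqs w c) * 2 ^ ((4 * R + 1) ^ 4 * Fintype.card (Orient 4)) := by
        rw [Finset.sum_const, smul_eq_mul]
    _ ≤ ((2 * b) ^ 4 * Fintype.card (Orient 4)) * 2 ^ ((4 * R + 1) ^ 4 * Fintype.card (Orient 4)) :=
        Nat.mul_le_mul_right _ (card_cellPlaqs_le hw c)

/-- **An atypical configuration exhibits a member of the choice set with total action above the budget** (`t₀, E₀ ≥ 0`):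
take an over-budget ball and in it the plaquettes with action `> t₀`; their excess is their action minus `t₀` each, so
their total action exceeds `E₀`; they are non-empty (the excess of the empty set is `0 ≤ E₀`) and lie within `2R` of
any one of them. -/
theorem exists_mem_excessChoices_of_notMem {w : Fin 4 → ℤ → ℤ} {t₀ : ℝ} (ht₀ : 0 ≤ t₀) {R : ℕ} {E₀ : ℝ}
    (hE₀ : 0 ≤ E₀) {c : Fin 4 → ℤ} {U : LGConfig 4 G} (hU : U ∉ typExcessSparse ρ w t₀ R E₀ c) :
    ∃ Q ∈ excessChoices w R c, E₀ < ∑ q ∈ Q, plaqAction ρ q U := by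
  classical
  simp only [typExcessSparse, Set.mem_setOf_eq, not_forall, not_le] at hU
  obtain ⟨x, hx⟩ := hU
  set Q : Finset (ZdPlaquette 4) := (ballPlaqs w c R x).filter fun q => t₀ < plaqAction ρ q U with hQ
  -- the excess of the ball is carried by `Q`
  have hexc : excessIn ρ w t₀ R c x U = ∑ q ∈ Q, (plaqAction ρ q U - t₀) := by
    unfold excessIn
    rw [hQ, Finset.sum_filter]
    refine Finset.sum_congr rfl fun q _ => ?_
    by_cases h : t₀ < plaqAction ρ q U
    · rw [if_pos h, max_eq_left (by linarith)]
    · rw [if_neg h, max_eq_right (by linarith)]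
  have hsumQ : E₀ < ∑ q ∈ Q, plaqAction ρ q U := by
    have h1 : ∑ q ∈ Q, (plaqAction ρ q U - t₀) = ∑ q ∈ Q, plaqAction ρ q U - #Q • t₀ := by
      rw [Finset.sum_sub_distrib, Finset.sum_const]
    rw [hexc, h1, nsmul_eq_mul] at hx
    have : (0 : ℝ) ≤ (#Q : ℝ) * t₀ := by positivity
    linarith
  -- `Q` is non-empty
  have hQne : Q.Nonempty := by
    rw [Finset.nonempty_iff_ne_empty]
    intro h
    rw [h, Finset.sum_empty] at hsumQ
    linarith
  obtain ⟨q₀, hq₀⟩ := hQne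
  have hQball : Q ⊆ ballPlaqs w c R x := Finset.filter_subset _ _
  have hq₀c : q₀ ∈ cellPlaqs w c := (Finset.mem_filter.1 (hQball hq₀)).1
  refine ⟨Q, Finset.mem_biUnion.2 ⟨q₀, hq₀c, Finset.mem_powerset.2 fun p hp => ?_⟩, hsumQ⟩
  have hpball := Finset.mem_filter.1 (hQball hp)
  refine Finset.mem_filter.2 ⟨hpball.1, fun i => ?_⟩
  have h1 : |p.1 i - x i| ≤ (R : ℤ) := hpball.2 i
  have h2 : |q₀.1 i - x i| ≤ (R : ℤ) := (Finset.mem_filter.1 (hQball hq₀)).2 i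
  calc |p.1 i - q₀.1 i| ≤ |p.1 i - x i| + |x i - q₀.1 i| := abs_sub_le _ _ _
    _ ≤ (R : ℤ) + (R : ℤ) := by rw [abs_sub_comm (x i)]; exact add_le_add h1 h2
    _ = 2 * (R : ℤ) := by ring

end Summit.QuantumFields.YangMills.Theorems.OddTorusChessboard

end
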